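import Literature.AlgebraicGeometry.Morphisms.ClosedImmersionNearFibreFlexible
import Literature.AlgebraicGeometry.Motives.MorphismsToProjectiveSpace
import Literature.AlgebraicGeometry.Motives.ProjBaseChangeAny
import Literature.AlgebraicGeometry.Motives.GeneratingSectionsComap
import Literature.AlgebraicGeometry.Motives.MorphismsToProjectiveSpaceBaseChange
import HarnessLib

/-!
# Fibrewise very ample ⇒ closed immersion into `ℙⁿ` over a neighbourhood of the fibre (EGA III 4.7.1, core step)

Topic `AlgebraicGeometry/Morphisms`; namespace `Literature.AlgebraicGeometry.Morphisms`. THEOREMS ONLY (no definition, no named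
fact, no instance, no `sorry`).

Let `f : X → Spec A` be PROPER and let `D : GeneratingSections (Fin (n+1)) X` be an invertible sheaf `𝓛` on `X` with `n + 1`
generating sections (★ `Motives/MorphismsToProjectiveSpace`, chart form), defining the `A`-morphism
`φ = D.toProj f : X → ℙⁿ_A`. Let `𝔭 ∈ Spec A` and let `X₀ = X ×_A κ(𝔭)` be the fibre, presented by ANY cartesian square over
`Spec (A → κ(𝔭))`, `κ(𝔭) = 𝔭.asIdeal.ResidueField`. If a `κ(𝔭)`-morphism `g₀ : X₀ → ℙⁿ_{κ(𝔭)}` compatible with `φ`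
through `ℙⁿ_{κ(𝔭)} → ℙⁿ_A` — e.g. the morphism defined by the RESTRICTED datum `D.comap (X₀ → X)` (`𝓛|_{X₀}` with the
restricted sections; ★ `GeneratingSections.comap_toProj`, `toProj_comp_SpecMap_algebraMap`) — is a closed immersion
(«`𝓛_𝔭` is very ample on the fibre, with these sections»), then for some `r ∉ 𝔭` the base change `X ×_A A_r → ℙⁿ_A ×_A A_r`
of `φ` is a CLOSED IMMERSION (**`exists_isClosedImmersion_pullbackMap_away_of_toProj`**, and
`exists_isClosedImmersion_pullbackMap_away_of_projectiveSpace` for an arbitrary `A`-morphism `φ : X → ℙⁿ_A`): `𝓛` is very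
ample relative to `Spec A_r`, a neighbourhood of `𝔭`; edition 2 adds the instance for the restricted datum itself,
**`exists_isClosedImmersion_pullbackMap_away_of_toProj_comap`** (hypothesis `IsClosedImmersion ((D.comap iX).toProj f₀)`, via ★
`GeneratingSections.comap_toProj` and ★ `GeneratingSections.toProj_comp_SpecMap_algebraMap`); edition 3 the form «very ample over
`Spec A_r`» in generating-sections currency, **`exists_isClosedImmersion_toProj_comap_away`**: the datum restricted to `X ×_A A_r`
defines a closed immersion `X ×_A A_r ↪ ℙⁿ_{A_r}` (through `ℙⁿ_{A_r} = ℙⁿ_A ×_A A_r`); edition 4 the same three statements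
with the fibre presented over ANY `A`-algebra `K` through which `Spec κ(𝔭) → Spec A` factors (`σ ≫ Spec(A → K) = Spec κ(𝔭) → Spec A`;
`…_of_isPullback_of_algebra`, `…_of_toProj_of_algebra`, `exists_isClosedImmersion_toProj_comap_away_of_algebra`) — the shape met after
a base change `A₀ → A = (A₀)_g` with `K = κ(𝔭₀)`. Also the TUBE LEMMA for closed morphisms (`exists_nhd_preimage_le_of_isClosedMap`,
`exists_away_preimage_basicOpen_le_of_isClosedMap`: an open containing a fibre contains the preimage of a neighbourhood /
of some `D(r) ∋ 𝔭`), by which open conditions («the sections generate») spread off the fibre. This is the core step of EGA III 4.7.1 («`𝓛_s` ample ⇒ `𝓛` ample relative to a neighbourhood of `s`»); the remaining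
steps — lifting the fibre's sections to a neighbourhood (cohomology and base change, ★ `Morphisms/SectionsLiftOfFibreVanishing`
(G3)) and spreading generation off the fibre — produce the datum `D` and are not in this file.

Proof: ★ `ProjBaseChangeRing.isPullback_projMap'` says `ℙⁿ_{κ(𝔭)} = ℙⁿ_A ×_A κ(𝔭)` and `ℙⁿ_A → Spec A` is proper
(★ `isProper_projToSpec`); ★ `exists_isClosedImmersion_pullbackMap_away_of_isPullback` (EGA III 4.6.7 (ii), flexible fibre
presentation, `Morphisms/ClosedImmersionNearFibreFlexible`) concludes.

Cell `hodgecm-mathlib`, F-DAG first hand (h2) «relative ampleness» (price sheet §3 F-2a / §5 item 2), leaf (B) core. Count-neutral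
capital (HC_CM is proved only modulo the 7 printed citations until rung 0 closes).

## References
* A. Grothendieck, J. Dieudonné, *EGA III₁* (1961), Thm. 4.7.1, Prop. 4.6.7 (ii). [EGAIII1]
* R. Hartshorne, *Algebraic Geometry* (1977), II Thm. 7.1, II Prop. 7.2. [Hartshorne1977]
-/

universe u

open CategoryTheory CategoryTheory.Limits AlgebraicGeometry TopologicalSpace
open Literature.AlgebraicGeometry.Motives Literature.AlgebraicGeometry.Motives.Segre

namespace Literature.AlgebraicGeometry.Morphisms

attribute [local instance] MvPolynomial.gradedAlgebra

/-! ### Spreading an open property off a fibre of a closed morphism (the tube argument) -/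

section Tube

variable {X S : Scheme.{u}} (f : X ⟶ S)

/-- **Tube lemma for closed morphisms.** If `f : X → S` is a closed map and the open `W ⊆ X` contains the fibre `f⁻¹(s)`, then
`W ⊇ f⁻¹(U)` for some open `U ∋ s` (namely `U = S ∖ f(X ∖ W)`). Used to spread «the sections generate» / «`g` is a closed
immersion» from a fibre to a neighbourhood (EGA III 4.6.7, 4.7.1). [cite: EGAIII1, Prop. 4.6.7 (ii)] -/
theorem exists_nhd_preimage_le_of_isClosedMap (hf : IsClosedMap f) (W : X.Opens) (s : S)
    (hW : ∀ x : X, f x = s → x ∈ W) : ∃ U : S.Opens, s ∈ U ∧ f ⁻¹ᵁ U ≤ W := by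
  have hcl : IsClosed (f '' ((W : Set X)ᶜ)) := hf _ W.isOpen.isClosed_compl
  refine ⟨⟨(f '' ((W : Set X)ᶜ))ᶜ, hcl.isOpen_compl⟩, ?_, ?_⟩
  · rintro ⟨x, hx, hxs⟩
    exact hx (hW x hxs)
  · intro x hx
    by_contra hxW
    exact hx ⟨x, hxW, rfl⟩

/-- **Tube lemma over an affine base.** If `f : X → Spec A` is a closed map and the open `W ⊆ X` contains the fibre over `𝔭`,
then `W ⊇ f⁻¹(D(r))` for some `r ∉ 𝔭`. [cite: EGAIII1, Prop. 4.6.7 (ii)] -/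
theorem exists_away_preimage_basicOpen_le_of_isClosedMap {A : Type u} [CommRing A] {X : Scheme.{u}} (f : X ⟶ Spec (.of A))
    (hf : IsClosedMap f) (W : X.Opens) (𝔭 : PrimeSpectrum A) (hW : ∀ x : X, f x = 𝔭 → x ∈ W) :
    ∃ r : A, r ∉ 𝔭.asIdeal ∧ f ⁻¹ᵁ (PrimeSpectrum.basicOpen r) ≤ W := by
  obtain ⟨U, h𝔭, hU⟩ := exists_nhd_preimage_le_of_isClosedMap f hf W 𝔭 hW
  obtain ⟨r, h𝔭r, hrU⟩ : ∃ r : A, r ∉ 𝔭.asIdeal ∧ (PrimeSpectrum.basicOpen r : Set (PrimeSpectrum A)) ⊆ (U : Set (Spec (.of A))) := by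
    obtain ⟨_, ⟨r, rfl⟩, h1, h2⟩ :=
      PrimeSpectrum.isTopologicalBasis_basic_opens.exists_subset_of_mem_open h𝔭 U.isOpen
    exact ⟨r, h1, h2⟩
  exact ⟨r, h𝔭r, fun x hx ↦ hU (hrU hx)⟩

end Tube

/-- **EGA III 4.7.1, core step: fibrewise closed immersion into `ℙⁿ` ⇒ closed immersion into `ℙⁿ` over `Spec A_r`.**
`f : X → Spec A` proper, `D` generating-sections data (`𝓛`, `s₀,…,sₙ`) on `X` with its `A`-morphism `D.toProj f : X → ℙⁿ_A`,
`X₀ = X ×_A κ(𝔭)` ANY cartesian square over `Spec (A → κ(𝔭))`, and `g₀ : X₀ → ℙⁿ_{κ(𝔭)}` ANY `κ(𝔭)`-morphism compatible with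
`D.toProj f` through the base change `ℙⁿ_{κ(𝔭)} → ℙⁿ_A` (for instance the morphism of the restricted datum, ★-to-be
`GeneratingSections.comap_toProj` + `toProj_comp_SpecMap_algebraMap`). If `g₀` is a closed immersion, then for some `r ∉ 𝔭`
the base change `X ×_A A_r → ℙⁿ_A ×_A A_r` of `D.toProj f` is a closed immersion (`ℙⁿ_{κ(𝔭)} = ℙⁿ_A ×_A κ(𝔭)` is ★
`ProjBaseChangeRing.isPullback_projMap'`; then ★ EGA III 4.6.7 (ii) in the flexible presentation). [cite: EGAIII1, Thm. 4.7.1]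
[cite: EGAIII1, Prop. 4.6.7 (ii)] -/
theorem exists_isClosedImmersion_pullbackMap_away_of_toProj {A : Type u} [CommRing A] {n : ℕ} {X : Scheme.{u}}
    (f : X ⟶ Spec (.of A)) [IsProper f] (D : GeneratingSections (Fin (n + 1)) X) (𝔭 : PrimeSpectrum A)
    {X₀ : Scheme.{u}} {iX : X₀ ⟶ X} {f₀ : X₀ ⟶ Spec (.of 𝔭.asIdeal.ResidueField)}
    (HX : IsPullback iX f₀ f (Spec.map (CommRingCat.ofHom (algebraMap A 𝔭.asIdeal.ResidueField))))
    (g₀ : X₀ ⟶ Proj (grading (Fin (n + 1)) 𝔭.asIdeal.ResidueField))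
    (h₁ : g₀ ≫ Proj.map (ProjBaseChangeRing.mapGraded A 𝔭.asIdeal.ResidueField (Fin (n + 1)))
        (ProjBaseChangeRing.irrelevant_le_map A 𝔭.asIdeal.ResidueField (Fin (n + 1))) = iX ≫ D.toProj f)
    (h₂ : g₀ ≫ toSpec (Fin (n + 1)) 𝔭.asIdeal.ResidueField = f₀) (hg₀ : IsClosedImmersion g₀) :
    ∃ r : A, r ∉ 𝔭.asIdeal ∧ ∀ e₁ e₂, IsClosedImmersion
      (pullback.map f (Spec.map (CommRingCat.ofHom (algebraMap A (Localization.Away r)))) (toSpec (Fin (n + 1)) A)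
        (Spec.map (CommRingCat.ofHom (algebraMap A (Localization.Away r)))) (D.toProj f) (𝟙 _) (𝟙 _) e₁ e₂) := by
  haveI : IsProper (toSpec (Fin (n + 1)) A) := ProjBaseChangeRing.isProper_projToSpec (Fin (n + 1)) A
  -- `ℙⁿ_{κ(𝔭)} = ℙⁿ_A ×_A κ(𝔭)`
  have HP : IsPullback
      (Proj.map (ProjBaseChangeRing.mapGraded A 𝔭.asIdeal.ResidueField (Fin (n + 1)))
        (ProjBaseChangeRing.irrelevant_le_map A 𝔭.asIdeal.ResidueField (Fin (n + 1))))
      (toSpec (Fin (n + 1)) 𝔭.asIdeal.ResidueField) (toSpec (Fin (n + 1)) A)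
      (Spec.map (CommRingCat.ofHom (algebraMap A 𝔭.asIdeal.ResidueField))) :=
    ProjBaseChangeRing.isPullback_projMap' A 𝔭.asIdeal.ResidueField
  exact exists_isClosedImmersion_pullbackMap_away_of_isPullback f (toSpec (Fin (n + 1)) A) (D.toProj f)
    (D.toProj_toSpec f) 𝔭 HX HP g₀ h₁ h₂ hg₀

/-- **The same for an arbitrary proper `X → Spec A` with an `A`-morphism `φ : X → ℙⁿ_A`** (not necessarily presented by
generating sections): if some `κ(𝔭)`-morphism `g₀ : X ×_A κ(𝔭) → ℙⁿ_{κ(𝔭)}` compatible with `φ` is a closed immersion, then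
`φ ×_A A_r` is a closed immersion for some `r ∉ 𝔭`. [cite: EGAIII1, Prop. 4.6.7 (ii)] -/
theorem exists_isClosedImmersion_pullbackMap_away_of_projectiveSpace {A : Type u} [CommRing A] {n : ℕ} {X : Scheme.{u}}
    (f : X ⟶ Spec (.of A)) [IsProper f] (φ : X ⟶ Proj (grading (Fin (n + 1)) A)) (hφ : φ ≫ toSpec (Fin (n + 1)) A = f)
    (𝔭 : PrimeSpectrum A) {X₀ : Scheme.{u}} {iX : X₀ ⟶ X} {f₀ : X₀ ⟶ Spec (.of 𝔭.asIdeal.ResidueField)}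
    (HX : IsPullback iX f₀ f (Spec.map (CommRingCat.ofHom (algebraMap A 𝔭.asIdeal.ResidueField))))
    (g₀ : X₀ ⟶ Proj (grading (Fin (n + 1)) 𝔭.asIdeal.ResidueField))
    (h₁ : g₀ ≫ Proj.map (ProjBaseChangeRing.mapGraded A 𝔭.asIdeal.ResidueField (Fin (n + 1)))
        (ProjBaseChangeRing.irrelevant_le_map A 𝔭.asIdeal.ResidueField (Fin (n + 1))) = iX ≫ φ)
    (h₂ : g₀ ≫ toSpec (Fin (n + 1)) 𝔭.asIdeal.ResidueField = f₀) (hg₀ : IsClosedImmersion g₀) :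
    ∃ r : A, r ∉ 𝔭.asIdeal ∧ ∀ e₁ e₂, IsClosedImmersion
      (pullback.map f (Spec.map (CommRingCat.ofHom (algebraMap A (Localization.Away r)))) (toSpec (Fin (n + 1)) A)
        (Spec.map (CommRingCat.ofHom (algebraMap A (Localization.Away r)))) φ (𝟙 _) (𝟙 _) e₁ e₂) := by
  haveI : IsProper (toSpec (Fin (n + 1)) A) := ProjBaseChangeRing.isProper_projToSpec (Fin (n + 1)) A
  have HP : IsPullback
      (Proj.map (ProjBaseChangeRing.mapGraded A 𝔭.asIdeal.ResidueField (Fin (n + 1)))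
        (ProjBaseChangeRing.irrelevant_le_map A 𝔭.asIdeal.ResidueField (Fin (n + 1))))
      (toSpec (Fin (n + 1)) 𝔭.asIdeal.ResidueField) (toSpec (Fin (n + 1)) A)
      (Spec.map (CommRingCat.ofHom (algebraMap A 𝔭.asIdeal.ResidueField))) :=
    ProjBaseChangeRing.isPullback_projMap' A 𝔭.asIdeal.ResidueField
  exact exists_isClosedImmersion_pullbackMap_away_of_isPullback f (toSpec (Fin (n + 1)) A) φ hφ 𝔭 HX HP g₀ h₁ h₂ hg₀

/-- **EGA III 4.7.1, core step, for the restricted datum.** As `exists_isClosedImmersion_pullbackMap_away_of_toProj` with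
`g₀` THE morphism `X₀ → ℙⁿ_{κ(𝔭)}` defined by the restricted generating sections `D.comap (X₀ → X)` (`𝓛|_{X₀}` with the
restricted sections): if it is a closed immersion («very ample on the fibre»), `D.toProj f` is a closed immersion over
`Spec A_r` for some `r ∉ 𝔭`. [cite: EGAIII1, Thm. 4.7.1] -/
theorem exists_isClosedImmersion_pullbackMap_away_of_toProj_comap {A : Type u} [CommRing A] {n : ℕ} {X : Scheme.{u}}
    (f : X ⟶ Spec (.of A)) [IsProper f] (D : GeneratingSections (Fin (n + 1)) X) (𝔭 : PrimeSpectrum A)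
    {X₀ : Scheme.{u}} {iX : X₀ ⟶ X} {f₀ : X₀ ⟶ Spec (.of 𝔭.asIdeal.ResidueField)}
    (HX : IsPullback iX f₀ f (Spec.map (CommRingCat.ofHom (algebraMap A 𝔭.asIdeal.ResidueField))))
    (H : IsClosedImmersion ((D.comap iX).toProj f₀)) :
    ∃ r : A, r ∉ 𝔭.asIdeal ∧ ∀ e₁ e₂, IsClosedImmersion
      (pullback.map f (Spec.map (CommRingCat.ofHom (algebraMap A (Localization.Away r)))) (toSpec (Fin (n + 1)) A)
        (Spec.map (CommRingCat.ofHom (algebraMap A (Localization.Away r)))) (D.toProj f) (𝟙 _) (𝟙 _) e₁ e₂) := by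
  refine exists_isClosedImmersion_pullbackMap_away_of_toProj f D 𝔭 HX ((D.comap iX).toProj f₀) ?_
    (GeneratingSections.toProj_toSpec _ _) H
  rw [← GeneratingSections.toProj_comp_SpecMap_algebraMap, ← HX.w, GeneratingSections.comap_toProj]

/-- **EGA III 4.7.1, core step — «very ample over `Spec A_r`» in generating-sections currency.** Under the hypotheses of
`exists_isClosedImmersion_pullbackMap_away_of_toProj_comap` (`f : X → Spec A` proper, `D` generating sections on `X`, the
restricted datum embeds the fibre `X_𝔭 ↪ ℙⁿ_{κ(𝔭)}`), for some `r ∉ 𝔭` the datum RESTRICTED TO `X ×_A A_r` defines a CLOSED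
IMMERSION `X ×_A A_r ↪ ℙⁿ_{A_r}` (its own `toProj` over `Spec A_r`): `𝓛|_{X_{A_r}}` with the restricted sections is very ample
relative to `Spec A_r` (`ℙⁿ_{A_r} = ℙⁿ_A ×_A A_r`, ★ `isPullback_projMap'`, and ★ `comap_toProj`). [cite: EGAIII1, Thm. 4.7.1] -/
theorem exists_isClosedImmersion_toProj_comap_away {A : Type u} [CommRing A] {n : ℕ} {X : Scheme.{u}}
    (f : X ⟶ Spec (.of A)) [IsProper f] (D : GeneratingSections (Fin (n + 1)) X) (𝔭 : PrimeSpectrum A)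
    {X₀ : Scheme.{u}} {iX : X₀ ⟶ X} {f₀ : X₀ ⟶ Spec (.of 𝔭.asIdeal.ResidueField)}
    (HX : IsPullback iX f₀ f (Spec.map (CommRingCat.ofHom (algebraMap A 𝔭.asIdeal.ResidueField))))
    (H : IsClosedImmersion ((D.comap iX).toProj f₀)) :
    ∃ r : A, r ∉ 𝔭.asIdeal ∧ IsClosedImmersion
      ((D.comap (pullback.fst f (Spec.map (CommRingCat.ofHom (algebraMap A (Localization.Away r)))))).toProj
        (pullback.snd f (Spec.map (CommRingCat.ofHom (algebraMap A (Localization.Away r)))))) := by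
  obtain ⟨r, hr, hci⟩ := exists_isClosedImmersion_pullbackMap_away_of_toProj_comap f D 𝔭 HX H
  refine ⟨r, hr, ?_⟩
  set ι := Spec.map (CommRingCat.ofHom (algebraMap A (Localization.Away r))) with hι
  -- `ℙⁿ_{A_r} = ℙⁿ_A ×_A A_r`
  have HP : IsPullback
      (Proj.map (ProjBaseChangeRing.mapGraded A (Localization.Away r) (Fin (n + 1)))
        (ProjBaseChangeRing.irrelevant_le_map A (Localization.Away r) (Fin (n + 1))))
      (toSpec (Fin (n + 1)) (Localization.Away r)) (toSpec (Fin (n + 1)) A) ι :=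
    ProjBaseChangeRing.isPullback_projMap' A (Localization.Away r)
  -- the restricted datum's morphism, followed by `ℙⁿ_{A_r} ≅ ℙⁿ_A ×_A A_r`, is the base change of `D.toProj f`
  have h₁ : (D.comap (pullback.fst f ι)).toProj (pullback.snd f ι) ≫
      Proj.map (ProjBaseChangeRing.mapGraded A (Localization.Away r) (Fin (n + 1)))
        (ProjBaseChangeRing.irrelevant_le_map A (Localization.Away r) (Fin (n + 1))) =
      pullback.fst f ι ≫ D.toProj f := by
    rw [← GeneratingSections.toProj_comp_SpecMap_algebraMap, ← pullback.condition, GeneratingSections.comap_toProj]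
  have h₂ : (D.comap (pullback.fst f ι)).toProj (pullback.snd f ι) ≫ toSpec (Fin (n + 1)) (Localization.Away r) =
      pullback.snd f ι := GeneratingSections.toProj_toSpec _ _
  have e₁ : f ≫ 𝟙 _ = D.toProj f ≫ toSpec (Fin (n + 1)) A := by rw [Category.comp_id, D.toProj_toSpec]
  have e₂ : ι ≫ 𝟙 _ = 𝟙 _ ≫ ι := by rw [Category.comp_id, Category.id_comp]
  have comm : (Iso.refl _).hom ≫ pullback.map f ι (toSpec (Fin (n + 1)) A) ι (D.toProj f) (𝟙 _) (𝟙 _) e₁ e₂ =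
      (D.comap (pullback.fst f ι)).toProj (pullback.snd f ι) ≫ HP.isoPullback.hom := by
    rw [Iso.refl_hom, Category.id_comp]
    apply pullback.hom_ext
    · rw [pullback.lift_fst, Category.assoc, IsPullback.isoPullback_hom_fst, h₁]
    · rw [pullback.lift_snd, Category.comp_id, Category.assoc, IsPullback.isoPullback_hom_snd, h₂]
  have e : Arrow.mk ((D.comap (pullback.fst f ι)).toProj (pullback.snd f ι)) ≅
      Arrow.mk (pullback.map f ι (toSpec (Fin (n + 1)) A) ι (D.toProj f) (𝟙 _) (𝟙 _) e₁ e₂) :=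
    Arrow.isoMk' _ _ (Iso.refl _) HP.isoPullback comm
  exact (MorphismProperty.arrow_mk_iso_iff @IsClosedImmersion e).mpr (hci e₁ e₂)


/-! ### The fibre presented over an arbitrary `A`-algebra `K` with `Spec κ(𝔭) → Spec K → Spec A` (edition 4) -/

section OverAlgebra

variable {A : Type u} [CommRing A] {n : ℕ} {X : Scheme.{u}} (f : X ⟶ Spec (.of A)) [IsProper f]
  (K : Type u) [CommRing K] [Algebra A K] (𝔭 : PrimeSpectrum A)
  (σ : Spec ((Spec (.of A)).residueField 𝔭) ⟶ Spec (.of K))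
  (hσ : σ ≫ Spec.map (CommRingCat.ofHom (algebraMap A K)) = (Spec (.of A)).fromSpecResidueField 𝔭)

include hσ

/-- **EGA III 4.6.7 (ii) over `Spec A`, fibre presented over ANY `A`-algebra `K` through which `κ(𝔭)` factors** (e.g.
`K = κ(𝔭)` itself, or `K = κ(𝔭₀)` for a prime `𝔭₀` of a smaller ring `A₀ → A` under `𝔭` with the same residue field — the
situation after a base change `A₀ → A = (A₀)_g`): `f` proper, `q` separated, `g ≫ q = f`, `X₀ = X ×_A K`, `P₀ = P ×_A K` any
cartesian squares, `g₀ : X₀ → P₀` a compatible closed immersion ⇒ `X ×_A A_r → P ×_A A_r` is a closed immersion for some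
`r ∉ 𝔭`. [cite: EGAIII1, Prop. 4.6.7 (ii)] -/
theorem exists_isClosedImmersion_pullbackMap_away_of_isPullback_of_algebra {P : Scheme.{u}} (q : P ⟶ Spec (.of A))
    [IsSeparated q] (g : X ⟶ P) (hg : g ≫ q = f) {X₀ P₀ : Scheme.{u}} {iX : X₀ ⟶ X} {f₀ : X₀ ⟶ Spec (.of K)}
    (HX : IsPullback iX f₀ f (Spec.map (CommRingCat.ofHom (algebraMap A K)))) {iP : P₀ ⟶ P} {q₀ : P₀ ⟶ Spec (.of K)}
    (HP : IsPullback iP q₀ q (Spec.map (CommRingCat.ofHom (algebraMap A K)))) (g₀ : X₀ ⟶ P₀)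
    (h₁ : g₀ ≫ iP = iX ≫ g) (h₂ : g₀ ≫ q₀ = f₀) (hg₀ : IsClosedImmersion g₀) :
    ∃ r : A, r ∉ 𝔭.asIdeal ∧ ∀ e₁ e₂, IsClosedImmersion
      (pullback.map f (Spec.map (CommRingCat.ofHom (algebraMap A (Localization.Away r)))) q
        (Spec.map (CommRingCat.ofHom (algebraMap A (Localization.Away r)))) g (𝟙 _) (𝟙 _) e₁ e₂) :=
  exists_isClosedImmersion_pullbackMap_away_of_fiber f q g hg 𝔭
    (isClosedImmersion_fiberToSpecResidueField_of_isPullback f q g hg 𝔭 σ hσ HX HP g₀ h₁ h₂ hg₀)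

/-- **EGA III 4.7.1, core step, fibre over any `A`-algebra `K` through which `κ(𝔭)` factors**: `D` generating sections on the
proper `X/A`, `X₀ = X ×_A K`, `g₀ : X₀ → ℙⁿ_K` compatible with `D.toProj f` through `ℙⁿ_K → ℙⁿ_A` and a closed immersion ⇒
`X ×_A A_r → ℙⁿ ×_A A_r` is a closed immersion for some `r ∉ 𝔭`. [cite: EGAIII1, Thm. 4.7.1] -/
theorem exists_isClosedImmersion_pullbackMap_away_of_toProj_of_algebra (D : GeneratingSections (Fin (n + 1)) X)
    {X₀ : Scheme.{u}} {iX : X₀ ⟶ X} {f₀ : X₀ ⟶ Spec (.of K)}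
    (HX : IsPullback iX f₀ f (Spec.map (CommRingCat.ofHom (algebraMap A K))))
    (g₀ : X₀ ⟶ Proj (grading (Fin (n + 1)) K))
    (h₁ : g₀ ≫ Proj.map (ProjBaseChangeRing.mapGraded A K (Fin (n + 1)))
        (ProjBaseChangeRing.irrelevant_le_map A K (Fin (n + 1))) = iX ≫ D.toProj f)
    (h₂ : g₀ ≫ toSpec (Fin (n + 1)) K = f₀) (hg₀ : IsClosedImmersion g₀) :
    ∃ r : A, r ∉ 𝔭.asIdeal ∧ ∀ e₁ e₂, IsClosedImmersion
      (pullback.map f (Spec.map (CommRingCat.ofHom (algebraMap A (Localization.Away r)))) (toSpec (Fin (n + 1)) A)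
        (Spec.map (CommRingCat.ofHom (algebraMap A (Localization.Away r)))) (D.toProj f) (𝟙 _) (𝟙 _) e₁ e₂) := by
  haveI : IsProper (toSpec (Fin (n + 1)) A) := ProjBaseChangeRing.isProper_projToSpec (Fin (n + 1)) A
  have HP : IsPullback
      (Proj.map (ProjBaseChangeRing.mapGraded A K (Fin (n + 1))) (ProjBaseChangeRing.irrelevant_le_map A K (Fin (n + 1))))
      (toSpec (Fin (n + 1)) K) (toSpec (Fin (n + 1)) A) (Spec.map (CommRingCat.ofHom (algebraMap A K))) :=
    ProjBaseChangeRing.isPullback_projMap' A K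
  exact exists_isClosedImmersion_pullbackMap_away_of_isPullback_of_algebra f K 𝔭 σ hσ (toSpec (Fin (n + 1)) A)
    (D.toProj f) (D.toProj_toSpec f) HX HP g₀ h₁ h₂ hg₀

/-- **EGA III 4.7.1, core step, restricted datum, fibre over any such `K`**: if `(D.comap iX).toProj f₀ : X₀ → ℙⁿ_K` is a closed
immersion then the datum restricted to `X ×_A A_r` embeds it into `ℙⁿ_{A_r}` for some `r ∉ 𝔭`. [cite: EGAIII1, Thm. 4.7.1] -/
theorem exists_isClosedImmersion_toProj_comap_away_of_algebra (D : GeneratingSections (Fin (n + 1)) X)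
    {X₀ : Scheme.{u}} {iX : X₀ ⟶ X} {f₀ : X₀ ⟶ Spec (.of K)}
    (HX : IsPullback iX f₀ f (Spec.map (CommRingCat.ofHom (algebraMap A K))))
    (H : IsClosedImmersion ((D.comap iX).toProj f₀)) :
    ∃ r : A, r ∉ 𝔭.asIdeal ∧ IsClosedImmersion
      ((D.comap (pullback.fst f (Spec.map (CommRingCat.ofHom (algebraMap A (Localization.Away r)))))).toProj
        (pullback.snd f (Spec.map (CommRingCat.ofHom (algebraMap A (Localization.Away r)))))) := by
  have h₁ : (D.comap iX).toProj f₀ ≫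
      Proj.map (ProjBaseChangeRing.mapGraded A K (Fin (n + 1))) (ProjBaseChangeRing.irrelevant_le_map A K (Fin (n + 1))) =
      iX ≫ D.toProj f := by
    rw [← GeneratingSections.toProj_comp_SpecMap_algebraMap, ← HX.w, GeneratingSections.comap_toProj]
  obtain ⟨r, hr, hci⟩ := exists_isClosedImmersion_pullbackMap_away_of_toProj_of_algebra f K 𝔭 σ hσ D HX
    ((D.comap iX).toProj f₀) h₁ (GeneratingSections.toProj_toSpec _ _) H
  refine ⟨r, hr, ?_⟩
  set ι := Spec.map (CommRingCat.ofHom (algebraMap A (Localization.Away r))) with hι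
  have HP : IsPullback
      (Proj.map (ProjBaseChangeRing.mapGraded A (Localization.Away r) (Fin (n + 1)))
        (ProjBaseChangeRing.irrelevant_le_map A (Localization.Away r) (Fin (n + 1))))
      (toSpec (Fin (n + 1)) (Localization.Away r)) (toSpec (Fin (n + 1)) A) ι :=
    ProjBaseChangeRing.isPullback_projMap' A (Localization.Away r)
  have h₁' : (D.comap (pullback.fst f ι)).toProj (pullback.snd f ι) ≫
      Proj.map (ProjBaseChangeRing.mapGraded A (Localization.Away r) (Fin (n + 1)))
        (ProjBaseChangeRing.irrelevant_le_map A (Localization.Away r) (Fin (n + 1))) =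
      pullback.fst f ι ≫ D.toProj f := by
    rw [← GeneratingSections.toProj_comp_SpecMap_algebraMap, ← pullback.condition, GeneratingSections.comap_toProj]
  have h₂' : (D.comap (pullback.fst f ι)).toProj (pullback.snd f ι) ≫ toSpec (Fin (n + 1)) (Localization.Away r) =
      pullback.snd f ι := GeneratingSections.toProj_toSpec _ _
  have e₁ : f ≫ 𝟙 _ = D.toProj f ≫ toSpec (Fin (n + 1)) A := by rw [Category.comp_id, D.toProj_toSpec]
  have e₂ : ι ≫ 𝟙 _ = 𝟙 _ ≫ ι := by rw [Category.comp_id, Category.id_comp]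
  have comm : (Iso.refl _).hom ≫ pullback.map f ι (toSpec (Fin (n + 1)) A) ι (D.toProj f) (𝟙 _) (𝟙 _) e₁ e₂ =
      (D.comap (pullback.fst f ι)).toProj (pullback.snd f ι) ≫ HP.isoPullback.hom := by
    rw [Iso.refl_hom, Category.id_comp]
    apply pullback.hom_ext
    · rw [pullback.lift_fst, Category.assoc, IsPullback.isoPullback_hom_fst, h₁']
    · rw [pullback.lift_snd, Category.comp_id, Category.assoc, IsPullback.isoPullback_hom_snd, h₂']
  have e : Arrow.mk ((D.comap (pullback.fst f ι)).toProj (pullback.snd f ι)) ≅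
      Arrow.mk (pullback.map f ι (toSpec (Fin (n + 1)) A) ι (D.toProj f) (𝟙 _) (𝟙 _) e₁ e₂) :=
    Arrow.isoMk' _ _ (Iso.refl _) HP.isoPullback comm
  exact (MorphismProperty.arrow_mk_iso_iff @IsClosedImmersion e).mpr (hci e₁ e₂)

end OverAlgebra

end Literature.AlgebraicGeometry.Morphisms
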